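import Literature.NumberTheory.EllipticCurves.DeShalit1987.KatzPAdicLFunction
import Literature.NumberTheory.EllipticCurves.IntSeriesIdentityPrinciple
import HarnessLib

/-!
# Rigidity of a twisted `ℤ_p`-branch of the Katz–de Shalit measure: two solutions of the frame
# `DeShalit1987.IsKatzBranch` with an infinite interpolation range inside a closed subdisc coincide (PROVED)

Topic `Literature/NumberTheory/EllipticCurves/DeShalit1987` (namespace = path). THEOREMS ONLY (no definition, no named
fact, no `sorry`, no `instance`).

WHY. The tree's frame `DeShalit1987.IsKatzBranch ι v v̄ S κ γ λ Ω δ Ω_p G` (de Shalit 1987 II.4.16 (49)–(50) along a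
`ℤ_p`-line, file `KatzPAdicLFunction.lean`) CHARACTERISES `G ∈ 𝒪_{ℂ_p}⟦T⟧` by its values at the in-range points
`T = r(γ) − 1` (`ρ` with geometric avatar `r` factoring through `κ`, `λρ` of type `(−m, j)`, `0 ≤ j < m`, unramified
outside `S ∪ {v̄}`); the existence fact `thmII414_exists_katzBranch` supplies SOME such `G`, and consumers (road α of cell
bsd-print-cf2: the `2`-adic Rubin value formula and the elliptic-unit descent, which read the OUT-OF-RANGE value
`G(0) = 𝓛_𝔭(λ)`) quantify over EVERY such `G`. Those consumer statements are meaningful only if the frame is RIGID: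
any two solutions agree. de Shalit's measure is of course unique; on the typed frame uniqueness is exactly the identity
principle for bounded series on a CLOSED subdisc (Gouvêa, *p-adic Numbers*, Cor. 5.6.3–5.6.4 — the tree's
`IntSeries.eq_of_infinite_hasValueAt_eq`; a bounded series may have infinitely many zeros in the OPEN disc, so the closed
subdisc is essential) applied to an INFINITE set of in-range points of norm `≤ ‖ϖ‖ < 1`. This file proves that reduction:

* `IsKatzBranch.eq_of_infinite_range` — two solutions `G, G'` of the same frame coincide as soon as infinitely many
  in-range interpolation points lie in a closed disc `‖x‖ ≤ ‖ϖ‖`, `0 < ‖ϖ‖ < 1`;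
* `IsKatzBranch.constantCoeff_eq_of_infinite_range` — in particular the out-of-range value `G(0)` (the constant
  coefficient) is then frame-determined.

What is NOT here (and is the arithmetic content in each application): the CHARACTER SUPPLY — that for the given
`(K, λ, κ, S)` infinitely many in-range `ρ` exist with `‖r(γ) − 1‖ ≤ ‖ϖ‖`; for `λ` ramified at `v` this requires `ρ`
with prescribed ramification at `v` (parity constraints on the infinity type when `p = 2`).

References: E. de Shalit, *Iwasawa theory of elliptic curves with complex multiplication* (1987), II.4.12 Remark (iv),
II.4.16 (49)–(50), II.4.17 (52)–(53) [deShalit1987]; F. Q. Gouvêa, *p-adic Numbers*, §5.6 Cor. 5.6.3–5.6.4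
[Gouvea1993PadicNumbers].
-/

noncomputable section

open scoped Classical
open NumberField IsDedekindDomain Field
open Literature.NumberTheory.GaloisRepresentations

namespace Literature.NumberTheory.EllipticCurves.DeShalit1987

universe u

variable {K : Type u} [Field K] [NumberField K] {p : ℕ} [Fact p.Prime]
variable {ι : PadicAlgCl p ≃+* ℂ} {v vbar : HeightOneSpectrum (𝓞 K)}
  {S : Finset (HeightOneSpectrum (𝓞 K))} {κ : ZpExtension K p} {γ : absoluteGaloisGroup K}
  {lam : HeckeCharacter K} {Ω δ : ℂ} {Ωp : ℂ_[p]} {G G' : PowerSeries (PadicComplexInt p)}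

/-- **Rigidity of the Katz branch frame.** If `G` and `G'` both satisfy `IsKatzBranch ι v v̄ S κ γ λ Ω δ Ω_p ·` and
infinitely many in-range interpolation points `x = r(γ) − 1` (for `ρ` with avatar `r` through `κ`, `λρ` of type `(−m, j)`,
`0 ≤ j < m`, unramified outside `S ∪ {v̄}`, with an entire continuation of `L(λρ, s)`) lie in a closed disc `‖x‖ ≤ ‖ϖ‖` with
`0 < ‖ϖ‖ < 1`, then `G = G'`: at each such point both series take de Shalit's value (50) (`IsKatzBranch.hasValueAt`), and
the identity principle on the closed subdisc (`IntSeries.eq_of_infinite_hasValueAt_eq`) concludes.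
[cite: deShalit1987, II.4.12 Remark (iv) and II.4.16 (49)–(50) (p. 66–67, 76–77)] [cite: Gouvea1993PadicNumbers, §5.6 Cor. 5.6.4] -/
theorem IsKatzBranch.eq_of_infinite_range (hG : IsKatzBranch ι v vbar S κ γ lam Ω δ Ωp G)
    (hG' : IsKatzBranch ι v vbar S κ γ lam Ω δ Ωp G') {ϖ : ℂ_[p]} (hϖ0 : ϖ ≠ 0) (hϖ : ‖ϖ‖ < 1)
    (h : {x : ℂ_[p] | ‖x‖ ≤ ‖ϖ‖ ∧
      ∃ (ρ : HeckeCharacter K) (r : FramedGaloisRep K (PadicAlgCl p) 1) (m j : ℕ),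
        IsPAdicAvatarOf ι ρ r ∧ FactorsThroughZp κ r ∧ j < m ∧
        (lam * ρ).HasInfinityType (fun _ ↦ -(m : ℤ)) (fun _ ↦ (j : ℤ)) ∧
        (∀ w : HeightOneSpectrum (𝓞 K), w ∉ S → w ≠ vbar → (lam * ρ).IsUnramifiedAt w) ∧
        LFunction.HasEntireContinuation (heckeLFunction (lam * ρ)) ∧
        x = avatarValueAt r γ - 1}.Infinite) :
    G = G' := by
  refine IntSeries.eq_of_infinite_hasValueAt_eq hϖ0 hϖ (h.mono fun x hx => ⟨hx.1, ?_⟩)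
  obtain ⟨ρ, r, m, j, hr, hκ, hjm, hinf, hunr, hL, rfl⟩ := hx.2
  exact ⟨_, hG.hasValueAt hr hκ hjm hinf hunr hL, hG'.hasValueAt hr hκ hjm hinf hunr hL⟩

/-- **The out-of-range value `G(0)` is frame-determined** (under the same infinite-range hypothesis): two solutions of the
frame have the same constant coefficient — the quantity `𝓛_𝔭(λ) = G(0)` read by Rubin-type value formulas at characters
outside the range of interpolation. [cite: deShalit1987, II.4.12 Remark (iv), II.4.17 (52)–(53) (p. 77–78)] -/
theorem IsKatzBranch.constantCoeff_eq_of_infinite_range (hG : IsKatzBranch ι v vbar S κ γ lam Ω δ Ωp G)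
    (hG' : IsKatzBranch ι v vbar S κ γ lam Ω δ Ωp G') {ϖ : ℂ_[p]} (hϖ0 : ϖ ≠ 0) (hϖ : ‖ϖ‖ < 1)
    (h : {x : ℂ_[p] | ‖x‖ ≤ ‖ϖ‖ ∧
      ∃ (ρ : HeckeCharacter K) (r : FramedGaloisRep K (PadicAlgCl p) 1) (m j : ℕ),
        IsPAdicAvatarOf ι ρ r ∧ FactorsThroughZp κ r ∧ j < m ∧
        (lam * ρ).HasInfinityType (fun _ ↦ -(m : ℤ)) (fun _ ↦ (j : ℤ)) ∧
        (∀ w : HeightOneSpectrum (𝓞 K), w ∉ S → w ≠ vbar → (lam * ρ).IsUnramifiedAt w) ∧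
        LFunction.HasEntireContinuation (heckeLFunction (lam * ρ)) ∧
        x = avatarValueAt r γ - 1}.Infinite) :
    PowerSeries.constantCoeff G = PowerSeries.constantCoeff G' := by
  rw [hG.eq_of_infinite_range hG' hϖ0 hϖ h]

end Literature.NumberTheory.EllipticCurves.DeShalit1987

end
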